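import Mathlib
import Literature.Analysis.FluidPDE.FluidComputerGadget
import HarnessLib

/-!
# The level ledger of a gadget cascade with `m` children: `E' = η E`, `U' = (η/m)^{1/2} λ^{3/2} U`,
# `Re' = (ηλ/m)^{1/2} Re`, `τ'/τ = (m/η)^{1/2} λ^{-5/2}`, loss per turnover `= 1/Re`, and the floor `η > m/λ`

Cell `ns-blowup` (host summit `NavierStokesRegularity`, negation side), seat `ns-blowup-fc-prover-1`
(D-0074 GROUP C «bridge support», door N1-FC «forced fluid computer»). HONEST FRAMING: low prior,
high value-of-information experiment on Tao's machine paradigm (J. Amer. Math. Soc. 29 (2016) §1.3);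
NOT a claim that NS blows up. WHAT THIS IS NOT: not Navier–Stokes — every declaration below is
DIMENSIONAL BOOKKEEPING (identities and inequalities between real numbers attached to the levels of a
would-be cascade); nothing is asserted about any flow. The audit typed here is the cell's KILLSHEET
§VI.3 "FC reduction line — audit for hidden assumptions" (refuter, 2026-08-25): "bookkeeping CORRECT
(`U' = η^{1/2}λ^{3/2}U`, `Re' = (ηλ)^{1/2}Re`, `τ'/τ = η^{-1/2}λ^{-5/2}`, loss/step `≍ 1/Re`); (i) ONE
packet per step is silently assumed — with `m` child packets `Re' = (ηλ/m)^{1/2} Re` and the floor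
becomes `η > m/λ` — state `m`".

## Dictionary

A cascade over the levels of a uniform gadget specification `σ : GadgetSpec`
(`Literature/Analysis/FluidPDE/FluidComputerGadget.lean`: scale ratio `λ = σ.s` between consecutive
levels, level wavenumber `σ.k n = k0 λⁿ`, efficiency `η = σ.eta` = fraction of the level energy found
one level down after a step) hands, at every step, the fraction `η` of a packet's energy to `m` CHILD
PACKETS of linear size `λ⁻¹` times the parent's (`m = 1`: Tao's one-child intermittency `α = 5/2`).
With the seed energy `E0` and POINT-LIKE concentration (`U² = k³ E`, the normal form
`cFloor · k³ · E ≤ ‖v x‖²` of the interface's concentration floor `GadgetLibrary.floor`):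

* `cascadeEnergy σ E0 n = E0 ηⁿ` (total level energy), `packetEnergy σ m E0 n = E0 (η/m)ⁿ`, `mⁿ`
  packets (`pow_card_mul_packetEnergy`);
* `packetSpeed = √(k³ · packetEnergy)`, `packetReynolds = packetSpeed / (ν k)`,
  `turnover = 1 / (k · packetSpeed)`, `packetVorticity = k · packetSpeed`,
  `reynoldsRatio σ m = (ηλ/m)^{1/2}`, `alphaEffChildren σ m = 5/2 - log (m/η) / (2 log λ)` (the
  acceleration exponent with `m` children; its theory is the companion file `GadgetLedgerDictionary.lean`);
* THE RECURSIONS (`…_succ`): `E' = ηE`, `U' = (ηλ/m)^{1/2} λ U` (`= η^{1/2} λ^{3/2} U` at `m = 1`),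
  `Re' = (ηλ/m)^{1/2} Re`, `τ' = τ / ((ηλ/m)^{1/2} λ²)` (`= η^{-1/2} λ^{-5/2} τ`), `ω' = (ηλ/m)^{1/2} λ² ω`
  (`= η^{1/2} λ^{5/2} ω`), and the viscous loss per turnover `ν k² τ = 1/Re`
  (`viscousLoss_mul_turnover`);
* THE FLOOR: the level Reynolds numbers CLIMB iff `η > m/λ` (`packetReynolds_lt_succ_iff`,
  `strictMono_packetReynolds_iff`, `tendsto_packetReynolds_atTop_iff`), are CONSTANT exactly at the
  floor `ηλ = m` — Leray / Type-I scaling `Uℓ = const` (`packetReynolds_eq_of_critical`) — and DIE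
  below it (`tendsto_packetReynolds_nhds_zero`); for `m = 1` the floor is the interface's threshold
  `λ⁻¹ < η` of `GadgetSpec.two_lt_alphaEff_iff` and the hypothesis `1 < ηλ` of a one-child trigger
  scheme (`one_lt_reynoldsRatio_one_iff`, `…_iff_inv`).

The `m`-children / codimension dictionary is the β-model's: `m` daughters of size `λ⁻¹` per mother give
an active set of dimension `D = log m / log λ` (U. Frisch, *Turbulence*, CUP 1995, §8.5.1
(8.20)–(8.21)); the ONE-SHOT (non-stationary: the whole level energy moves down in one step) Reynolds
recursion above is the machine-paradigm heuristic of Tao 2016 §1.3 (there `m = 1`, `λ = 1 + ε₀`),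
written out — folklore dimensional analysis, which is why it lives summit-side next to the cell's other
dictionaries (`AmplitudeLedger`, `CirculationLedger`) and not under `Literature/`.

Deliberately NOT here: no claim that any flow realises the ledger; no change to `GadgetSpec` /
`GadgetLibrary` (frozen interface keys); the amplitude-side dictionary (`r = g/λ`, `Dc_sup`,
`codim_star`) is `AmplitudeLedger.lean` and is not restated — the companion file identifies
`reynoldsRatio σ m` with the `reGain` of the amplitude sequence `packetSpeed σ m E0` and computes its
`dcSup = 3 - log m / log λ`. 0 sorry; axioms ⊆ {propext, Classical.choice, Quot.sound}.
-/

noncomputable section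

open Filter
open scoped Topology

namespace Summit.NavierStokesRegularity.FluidComputer.GadgetLedger

open Literature.Analysis.FluidPDE Literature.Analysis.FluidPDE.FluidComputer

variable (σ : GadgetSpec)

/-! ## The ledger: definitions -/

/-- Total energy at level `n` of the cascade seeded with energy `E0`: `E0 · ηⁿ` (`E_{k+1} = η E_k`).
-/
def cascadeEnergy (E0 : ℝ) (n : ℕ) : ℝ := E0 * σ.eta ^ n

/-- Energy of ONE packet at level `n` when every step hands the fraction `η` of a packet's energy to `m`
children: `E0 · (η/m)ⁿ`. -/
def packetEnergy (m : ℕ) (E0 : ℝ) (n : ℕ) : ℝ := E0 * (σ.eta / m) ^ n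

/-- Speed scale of a level-`n` packet under point-like concentration, `U_n = √(k_n³ · E_n)`
(`U² ℓ³ = E` with `ℓ = 1/k`; the normal form `cFloor · k³ · E ≤ ‖v x‖²` of `GadgetLibrary.floor`).
-/
def packetSpeed (m : ℕ) (E0 : ℝ) (n : ℕ) : ℝ := Real.sqrt (σ.k n ^ 3 * packetEnergy σ m E0 n)

/-- Level Reynolds number of a packet, `Re_n = U_n ℓ_n / ν = U_n / (ν k_n)`. -/
def packetReynolds (m : ℕ) (ν E0 : ℝ) (n : ℕ) : ℝ := packetSpeed σ m E0 n / (ν * σ.k n)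

/-- Turnover (step) time of a level-`n` packet, `τ_n = ℓ_n / U_n = 1 / (k_n U_n)`. -/
def turnover (m : ℕ) (E0 : ℝ) (n : ℕ) : ℝ := 1 / (σ.k n * packetSpeed σ m E0 n)

/-- Vorticity scale of a level-`n` packet, `ω_n = U_n / ℓ_n = k_n U_n`. -/
def packetVorticity (m : ℕ) (E0 : ℝ) (n : ℕ) : ℝ := σ.k n * packetSpeed σ m E0 n

/-- The per-step ratio of level Reynolds numbers with `m` children, `(η λ / m)^{1/2}`. -/
def reynoldsRatio (m : ℕ) : ℝ := Real.sqrt (σ.eta * σ.s / m)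

/-- The acceleration exponent of the transfer-time law produced by a self-similar gadget with `m`
children per step, `5/2 - log (m/η) / (2 log λ)`; `m = 1` is `GadgetSpec.alphaEff`. -/
def alphaEffChildren (m : ℕ) : ℝ := 5 / 2 - Real.log (m / σ.eta) / (2 * Real.log σ.s)

variable {σ}

/-! ## Signs -/

/-- Level wavenumbers step by the scale ratio: `k (n+1) = λ · k n`. -/
lemma k_succ (n : ℕ) : σ.k (n + 1) = σ.s * σ.k n := by
  unfold GadgetSpec.k; rw [pow_succ]; ring

/-- `k n = k0 · λⁿ`, restated with the power on the right for rewriting. -/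
lemma k_eq (n : ℕ) : σ.k n = σ.k0 * σ.s ^ n := rfl

/-- Packet energies are positive for a positive seed energy. -/
lemma packetEnergy_pos (hσ : σ.Valid) {m : ℕ} (hm : 0 < m) {E0 : ℝ} (hE0 : 0 < E0) (n : ℕ) :
    0 < packetEnergy σ m E0 n :=
  mul_pos hE0 (pow_pos (div_pos hσ.eta_pos (Nat.cast_pos.2 hm)) n)

/-- Packet speeds are positive. -/
lemma packetSpeed_pos (hσ : σ.Valid) {m : ℕ} (hm : 0 < m) {E0 : ℝ} (hE0 : 0 < E0) (n : ℕ) :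
    0 < packetSpeed σ m E0 n :=
  Real.sqrt_pos.2 (mul_pos (pow_pos (GadgetSpec.k_pos hσ n) 3) (packetEnergy_pos hσ hm hE0 n))

/-- Level Reynolds numbers are positive (`ν > 0`). -/
lemma packetReynolds_pos (hσ : σ.Valid) {m : ℕ} (hm : 0 < m) {ν E0 : ℝ} (hν : 0 < ν) (hE0 : 0 < E0)
    (n : ℕ) : 0 < packetReynolds σ m ν E0 n :=
  div_pos (packetSpeed_pos hσ hm hE0 n) (mul_pos hν (GadgetSpec.k_pos hσ n))

/-- Turnover times are positive. -/
lemma turnover_pos (hσ : σ.Valid) {m : ℕ} (hm : 0 < m) {E0 : ℝ} (hE0 : 0 < E0) (n : ℕ) :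
    0 < turnover σ m E0 n :=
  one_div_pos.2 (mul_pos (GadgetSpec.k_pos hσ n) (packetSpeed_pos hσ hm hE0 n))

/-- Vorticity scales are positive. -/
lemma packetVorticity_pos (hσ : σ.Valid) {m : ℕ} (hm : 0 < m) {E0 : ℝ} (hE0 : 0 < E0) (n : ℕ) :
    0 < packetVorticity σ m E0 n :=
  mul_pos (GadgetSpec.k_pos hσ n) (packetSpeed_pos hσ hm hE0 n)

/-- The Reynolds ratio is positive for valid specs and `m ≥ 1`. -/
lemma reynoldsRatio_pos (hσ : σ.Valid) {m : ℕ} (hm : 0 < m) : 0 < reynoldsRatio σ m :=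
  Real.sqrt_pos.2 (div_pos (mul_pos hσ.eta_pos (zero_lt_one.trans hσ.one_lt_s)) (Nat.cast_pos.2 hm))

/-- `reynoldsRatio m · λ = (η λ³ / m)^{1/2}`: the amplitude gain per step (`U'/U`). -/
lemma reynoldsRatio_mul_s (hσ : σ.Valid) (m : ℕ) :
    reynoldsRatio σ m * σ.s = Real.sqrt (σ.eta * σ.s ^ 3 / m) := by
  have hs : 0 ≤ σ.s := (zero_lt_one.trans hσ.one_lt_s).le
  unfold reynoldsRatio
  rw [show σ.eta * σ.s ^ 3 / m = σ.eta * σ.s / m * σ.s ^ 2 by ring,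
    Real.sqrt_mul' _ (sq_nonneg σ.s), Real.sqrt_sq hs]

/-! ## The recursions ("bookkeeping CORRECT", KILLSHEET §VI.3) -/

/-- `E_{n+1} = η · E_n`. -/
theorem cascadeEnergy_succ (E0 : ℝ) (n : ℕ) :
    cascadeEnergy σ E0 (n + 1) = σ.eta * cascadeEnergy σ E0 n := by
  unfold cascadeEnergy; rw [pow_succ]; ring

/-- Per packet: `E_{n+1} = (η/m) · E_n`. -/
theorem packetEnergy_succ (m : ℕ) (E0 : ℝ) (n : ℕ) :
    packetEnergy σ m E0 (n + 1) = σ.eta / m * packetEnergy σ m E0 n := by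
  unfold packetEnergy; rw [pow_succ]; ring

/-- The `mⁿ` packets of level `n` carry the total level energy: `mⁿ · packetEnergy n = E0 ηⁿ`.
-/
theorem pow_card_mul_packetEnergy {m : ℕ} (hm : 0 < m) (E0 : ℝ) (n : ℕ) :
    (m : ℝ) ^ n * packetEnergy σ m E0 n = cascadeEnergy σ E0 n := by
  have hm' : (m : ℝ) ≠ 0 := (Nat.cast_pos.2 hm).ne'
  unfold packetEnergy cascadeEnergy
  rw [mul_left_comm, ← mul_pow, mul_div_cancel₀ _ hm']

/-- `U_{n+1} = (ηλ/m)^{1/2} · λ · U_n` (`= η^{1/2} λ^{3/2} U_n` for one child; `reynoldsRatio_mul_s`).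
-/
theorem packetSpeed_succ (hσ : σ.Valid) (m : ℕ) (E0 : ℝ) (n : ℕ) :
    packetSpeed σ m E0 (n + 1) = reynoldsRatio σ m * σ.s * packetSpeed σ m E0 n := by
  have hs : 0 ≤ σ.s := (zero_lt_one.trans hσ.one_lt_s).le
  have hq : 0 ≤ σ.eta * σ.s ^ 3 / m :=
    div_nonneg (mul_nonneg hσ.eta_pos.le (pow_nonneg hs 3)) (Nat.cast_nonneg m)
  rw [reynoldsRatio_mul_s hσ]
  unfold packetSpeed
  rw [k_succ, packetEnergy_succ,
    show (σ.s * σ.k n) ^ 3 * (σ.eta / m * packetEnergy σ m E0 n) =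
      σ.eta * σ.s ^ 3 / m * (σ.k n ^ 3 * packetEnergy σ m E0 n) by ring,
    Real.sqrt_mul hq]

/-- `Re_{n+1} = (ηλ/m)^{1/2} · Re_n`. -/
theorem packetReynolds_succ (hσ : σ.Valid) (m : ℕ) (ν E0 : ℝ) (n : ℕ) :
    packetReynolds σ m ν E0 (n + 1) = reynoldsRatio σ m * packetReynolds σ m ν E0 n := by
  have hs : σ.s ≠ 0 := (zero_lt_one.trans hσ.one_lt_s).ne'
  unfold packetReynolds
  rw [packetSpeed_succ hσ, k_succ, mul_comm σ.s (σ.k n), ← mul_assoc ν, mul_assoc (reynoldsRatio σ m),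
    mul_comm σ.s (packetSpeed σ m E0 n), mul_div_assoc, mul_div_mul_right _ _ hs]

/-- `ω_{n+1} = (ηλ/m)^{1/2} λ² · ω_n` (`= η^{1/2} λ^{5/2} ω_n` for one child). -/
theorem packetVorticity_succ (hσ : σ.Valid) (m : ℕ) (E0 : ℝ) (n : ℕ) :
    packetVorticity σ m E0 (n + 1) = reynoldsRatio σ m * σ.s ^ 2 * packetVorticity σ m E0 n := by
  unfold packetVorticity
  rw [packetSpeed_succ hσ, k_succ]
  ring

/-- `τ_{n+1} = τ_n / ((ηλ/m)^{1/2} λ²)` (`τ'/τ = η^{-1/2} λ^{-5/2}` for one child). -/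
theorem turnover_succ (hσ : σ.Valid) {m : ℕ} (hm : 0 < m) {E0 : ℝ} (hE0 : 0 < E0) (n : ℕ) :
    turnover σ m E0 (n + 1) = turnover σ m E0 n / (reynoldsRatio σ m * σ.s ^ 2) := by
  have hs : σ.s ≠ 0 := (zero_lt_one.trans hσ.one_lt_s).ne'
  have hk : σ.k n ≠ 0 := (GadgetSpec.k_pos hσ n).ne'
  have hU : packetSpeed σ m E0 n ≠ 0 := (packetSpeed_pos hσ hm hE0 n).ne'
  have hr : reynoldsRatio σ m ≠ 0 := (reynoldsRatio_pos hσ hm).ne'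
  unfold turnover
  rw [packetSpeed_succ hσ, k_succ]
  field_simp

/-- Viscous loss per turnover: the fraction `ν k_n² τ_n` of a packet's energy dissipated during one
turnover (rate `ν k²` times the time `τ`) is `1 / Re_n` ("loss/step `≍ 1/Re_k`"). -/
theorem viscousLoss_mul_turnover (hσ : σ.Valid) {m : ℕ} (hm : 0 < m) {ν E0 : ℝ} (hν : 0 < ν)
    (hE0 : 0 < E0) (n : ℕ) :
    ν * σ.k n ^ 2 * turnover σ m E0 n = 1 / packetReynolds σ m ν E0 n := by
  have hk : σ.k n ≠ 0 := (GadgetSpec.k_pos hσ n).ne'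
  have hU : packetSpeed σ m E0 n ≠ 0 := (packetSpeed_pos hσ hm hE0 n).ne'
  unfold turnover packetReynolds
  field_simp

/-- Closed form: `Re_n = Re_0 · ((ηλ/m)^{1/2})ⁿ`. -/
theorem packetReynolds_eq_mul_pow (hσ : σ.Valid) (m : ℕ) (ν E0 : ℝ) (n : ℕ) :
    packetReynolds σ m ν E0 n = packetReynolds σ m ν E0 0 * reynoldsRatio σ m ^ n := by
  induction n with
  | zero => simp
  | succ n ih => rw [packetReynolds_succ hσ, ih, pow_succ]; ring

/-- Closed form: `τ_n = τ_0 · (((ηλ/m)^{1/2} λ²)⁻¹)ⁿ`. -/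
theorem turnover_eq_mul_pow (hσ : σ.Valid) {m : ℕ} (hm : 0 < m) {E0 : ℝ} (hE0 : 0 < E0) (n : ℕ) :
    turnover σ m E0 n = turnover σ m E0 0 * ((reynoldsRatio σ m * σ.s ^ 2)⁻¹) ^ n := by
  induction n with
  | zero => simp
  | succ n ih => rw [turnover_succ hσ hm hE0, ih, pow_succ, div_eq_mul_inv]; ring

/-! ## The floor `η > m/λ` (KILLSHEET §VI.3 (i): "with `m` child packets … the floor becomes `η > m/λ`") -/

/-- `1 < (ηλ/m)^{1/2} ↔ m/λ < η`. -/
theorem one_lt_reynoldsRatio_iff (hσ : σ.Valid) {m : ℕ} (hm : 0 < m) :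
    1 < reynoldsRatio σ m ↔ (m : ℝ) / σ.s < σ.eta := by
  have hs : 0 < σ.s := zero_lt_one.trans hσ.one_lt_s
  have hm' : (0 : ℝ) < m := Nat.cast_pos.2 hm
  unfold reynoldsRatio
  rw [Real.lt_sqrt zero_le_one, one_pow, one_lt_div hm', div_lt_iff₀ hs]

/-- `1 ≤ (ηλ/m)^{1/2} ↔ m/λ ≤ η`. -/
theorem one_le_reynoldsRatio_iff (hσ : σ.Valid) {m : ℕ} (hm : 0 < m) :
    1 ≤ reynoldsRatio σ m ↔ (m : ℝ) / σ.s ≤ σ.eta := by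
  have hs : 0 < σ.s := zero_lt_one.trans hσ.one_lt_s
  have hm' : (0 : ℝ) < m := Nat.cast_pos.2 hm
  unfold reynoldsRatio
  rw [Real.le_sqrt' one_pos, one_pow, one_le_div hm', div_le_iff₀ hs]

/-- `(ηλ/m)^{1/2} < 1 ↔ η < m/λ`. -/
theorem reynoldsRatio_lt_one_iff (hσ : σ.Valid) {m : ℕ} (hm : 0 < m) :
    reynoldsRatio σ m < 1 ↔ σ.eta < (m : ℝ) / σ.s := by
  rw [← not_le, one_le_reynoldsRatio_iff hσ hm, not_le]

/-- AT the floor, `ηλ = m`, the Reynolds ratio is exactly `1`. -/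
theorem reynoldsRatio_eq_one_of_critical {m : ℕ} (hm : 0 < m) (h : σ.eta * σ.s = m) :
    reynoldsRatio σ m = 1 := by
  have hm' : (m : ℝ) ≠ 0 := (Nat.cast_pos.2 hm).ne'
  unfold reynoldsRatio
  rw [h, div_self hm', Real.sqrt_one]

/-- One child: `1 < reynoldsRatio 1 ↔ 1 < ηλ` — the hypothesis of a one-child trigger scheme and, as
`λ⁻¹ < η`, the threshold of `GadgetSpec.two_lt_alphaEff_iff`. -/
theorem one_lt_reynoldsRatio_one_iff (hσ : σ.Valid) :
    1 < reynoldsRatio σ 1 ↔ 1 < σ.eta * σ.s := by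
  have hs : 0 < σ.s := zero_lt_one.trans hσ.one_lt_s
  rw [one_lt_reynoldsRatio_iff hσ one_pos, Nat.cast_one, div_lt_iff₀ hs]

/-- One child, inverse spelling: `1 < reynoldsRatio 1 ↔ λ⁻¹ < η`. -/
theorem one_lt_reynoldsRatio_one_iff_inv (hσ : σ.Valid) :
    1 < reynoldsRatio σ 1 ↔ σ.s⁻¹ < σ.eta := by
  rw [one_lt_reynoldsRatio_iff hσ one_pos, Nat.cast_one, one_div]

/-- THE FLOOR, one step: `Re_n < Re_{n+1} ↔ m/λ < η`. -/
theorem packetReynolds_lt_succ_iff (hσ : σ.Valid) {m : ℕ} (hm : 0 < m) {ν E0 : ℝ} (hν : 0 < ν)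
    (hE0 : 0 < E0) (n : ℕ) :
    packetReynolds σ m ν E0 n < packetReynolds σ m ν E0 (n + 1) ↔ (m : ℝ) / σ.s < σ.eta := by
  rw [packetReynolds_succ hσ, lt_mul_iff_one_lt_left (packetReynolds_pos hσ hm hν hE0 n),
    one_lt_reynoldsRatio_iff hσ hm]

/-- One step, weak form: `Re_n ≤ Re_{n+1} ↔ m/λ ≤ η`. -/
theorem packetReynolds_le_succ_iff (hσ : σ.Valid) {m : ℕ} (hm : 0 < m) {ν E0 : ℝ} (hν : 0 < ν)
    (hE0 : 0 < E0) (n : ℕ) :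
    packetReynolds σ m ν E0 n ≤ packetReynolds σ m ν E0 (n + 1) ↔ (m : ℝ) / σ.s ≤ σ.eta := by
  rw [packetReynolds_succ hσ, le_mul_iff_one_le_left (packetReynolds_pos hσ hm hν hE0 n),
    one_le_reynoldsRatio_iff hσ hm]

/-- THE FLOOR, growth: the level Reynolds numbers climb strictly iff `η > m/λ`. -/
theorem strictMono_packetReynolds_iff (hσ : σ.Valid) {m : ℕ} (hm : 0 < m) {ν E0 : ℝ} (hν : 0 < ν)
    (hE0 : 0 < E0) :
    StrictMono (packetReynolds σ m ν E0) ↔ (m : ℝ) / σ.s < σ.eta := by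
  constructor
  · intro h
    exact (packetReynolds_lt_succ_iff hσ hm hν hE0 0).1 (h Nat.zero_lt_one)
  · intro h
    exact strictMono_nat_of_lt_succ fun n => (packetReynolds_lt_succ_iff hσ hm hν hE0 n).2 h

/-- THE FLOOR, divergence: `Re_n → ∞` iff `η > m/λ` (above the floor the cascade is eventually above
every operating threshold; at or below it, never). -/
theorem tendsto_packetReynolds_atTop_iff (hσ : σ.Valid) {m : ℕ} (hm : 0 < m) {ν E0 : ℝ} (hν : 0 < ν)
    (hE0 : 0 < E0) :
    Tendsto (packetReynolds σ m ν E0) atTop atTop ↔ (m : ℝ) / σ.s < σ.eta := by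
  have hRe0 := packetReynolds_pos hσ hm hν hE0 0
  have hfun : packetReynolds σ m ν E0 = fun n => packetReynolds σ m ν E0 0 * reynoldsRatio σ m ^ n :=
    funext fun n => packetReynolds_eq_mul_pow hσ m ν E0 n
  constructor
  · intro h
    by_contra hlt
    have hr : reynoldsRatio σ m ≤ 1 := not_lt.1 (mt (one_lt_reynoldsRatio_iff hσ hm).1 hlt)
    have hbound : ∀ n, packetReynolds σ m ν E0 n ≤ packetReynolds σ m ν E0 0 := by
      intro n
      rw [packetReynolds_eq_mul_pow hσ m ν E0 n]
      exact mul_le_of_le_one_right hRe0.le (pow_le_one₀ (reynoldsRatio_pos hσ hm).le hr)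
    obtain ⟨n, hn⟩ := (h.eventually_gt_atTop (packetReynolds σ m ν E0 0)).exists
    exact absurd (hbound n) (not_le.2 hn)
  · intro h
    rw [hfun]
    exact (tendsto_pow_atTop_atTop_of_one_lt ((one_lt_reynoldsRatio_iff hσ hm).2 h)).const_mul_atTop
      hRe0

/-- AT the floor (`ηλ = m`): every level has the seed's Reynolds number — Leray / Type-I scaling
`U ℓ = const`. -/
theorem packetReynolds_eq_of_critical (hσ : σ.Valid) {m : ℕ} (hm : 0 < m) (h : σ.eta * σ.s = m)
    (ν E0 : ℝ) (n : ℕ) : packetReynolds σ m ν E0 n = packetReynolds σ m ν E0 0 := by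
  rw [packetReynolds_eq_mul_pow hσ, reynoldsRatio_eq_one_of_critical hm h, one_pow, mul_one]

/-- BELOW the floor (`η < m/λ`) the level Reynolds numbers die: `Re_n → 0`. -/
theorem tendsto_packetReynolds_nhds_zero (hσ : σ.Valid) {m : ℕ} (hm : 0 < m) (ν E0 : ℝ)
    (h : σ.eta < (m : ℝ) / σ.s) : Tendsto (packetReynolds σ m ν E0) atTop (𝓝 0) := by
  have hfun : packetReynolds σ m ν E0 = fun n => packetReynolds σ m ν E0 0 * reynoldsRatio σ m ^ n :=
    funext fun n => packetReynolds_eq_mul_pow hσ m ν E0 n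
  rw [hfun]
  simpa using (tendsto_pow_atTop_nhds_zero_of_lt_one (reynoldsRatio_pos hσ hm).le
    ((reynoldsRatio_lt_one_iff hσ hm).2 h)).const_mul (packetReynolds σ m ν E0 0)

end Summit.NavierStokesRegularity.FluidComputer.GadgetLedger

end
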